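import Summits.CriticalPhenomena.PercolationContinuityZ3.Theses.PercNearOneGluing
import Summits.CriticalPhenomena.PercolationContinuityZ3.Theorems.PercNearOneGluingAdditiveGluingML5DriverTools

/-!
# Crux `PercNearOneGluing.AdditiveGluing` (stmt-CriticalPhenomena-4576), line `tieline`: (K₀) ⟸ covariance transfer

Support file (`--supports stmt-CriticalPhenomena-4576`, helper, lead c9 §11).  No definitions, no named facts, no sorries.

Weighted graph on `Fin n` (`μ = prodBernoulli w`), target `b`, relays `a₁, a₂` with `a₂` the WEAKER one
(`τ_{a₂} = μ(a₂ ↔ b) ≤ μ(a₁ ↔ b) = τ_{a₁}`), observer `o`, spectator `c`.  Put `u = a₂`, `v = a₁`, `D = {u ↮ v}`,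
`N = {c ↮ a₁} ∩ {c ↮ a₂}`, `NJ = N ∩ {o ↔ c}` and, for `x ∈ {o, c}`,
`P_x = μ(D ∩ {v ↔ b} ∩ {x ↮ u})`, `Q_x = μ(D ∩ {u ↔ b} ∩ {v ↔ x})`, `a_x = μ(D ∩ {v ↔ x})`,
`G_x = μ({x ↮ b} ∩ ({x ↔ a₁} ∪ {x ↔ a₂}) ∩ ({a₁ ↔ b} ∪ {a₂ ↔ b}))` (the exact pair-gluing gain of `x`),
`M = μ(a₁↔b ∪ a₂↔b) − τ_{a₂}`.

The **slack-inheritance kernel (K₀)** (registered stub `stub_k0_dp`, the hypothesis of the landed two-step three-relay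
reduction `threeRelaysFullTieAllBad_of_k0`) is `μ(NJ)·(M − G_c) ≤ μ(N)·(M − G_o)`.  This file derives it from
* (α) the covariance transfer for `P` (registered stub `stub_k0CovTransferP_c9`, hypothesis `hP`):
  `μ(D ∩ v↔b)·(a_o μ(N) − a_c μ(NJ)) ≤ μ(D)·(P_o μ(N) − P_c μ(NJ))`;
* (β) the covariance transfer for `Q` (registered stub `stub_k0CovTransferQ_c9`, hypothesis `hQ`):
  `μ(D)·(Q_o μ(N) − Q_c μ(NJ)) ≤ μ(D ∩ u↔b)·(a_o μ(N) − a_c μ(NJ))`;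
* (γ) the attachment transfer (registered stub `stub_k0AttachTransfer_c9`, LANDED in
  `…Theorems/PercNearOneGluingAdditiveGluingK0AttachTransfer.lean`; taken here as the hypothesis `hA` because that module's
  olean was not yet available on the farm when this file was checked): `a_c μ(NJ) ≤ a_o μ(N)`;
* the τ-order on `D`: `μ(D ∩ u↔b) ≤ μ(D ∩ v↔b)` (`= τ_{a₁} − τ_{a₂} + μ(D ∩ u↔b)`, `K0OfCovTransfer.real_D_inter_le`).
Chaining, `μ(D)·(P_o μ(N) − P_c μ(NJ)) ≥ μ(D ∩ v↔b)·S ≥ μ(D ∩ u↔b)·S ≥ μ(D)·(Q_o μ(N) − Q_c μ(NJ))` with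
`S = a_o μ(N) − a_c μ(NJ) ≥ 0`, whence `(P_o − Q_o) μ(N) ≥ (P_c − Q_c) μ(NJ)` (trivially so if `μ(D) = 0`); and this is
(K₀) by the identifications `M = μ(D ∩ v↔b)` (`K0OfCovTransfer.real_gainMax_eq`) and `G_x = μ(D ∩ v↔b) − P_x + Q_x`
(`K0OfCovTransfer.real_gain_eq`: the gain event of `x` is the disjoint union of `D ∩ {v↔b} ∩ {x↔u}` and
`D ∩ {u↔b} ∩ {v↔x}`), i.e. `M − G_x = P_x − Q_x`.
[cite: KozmaNitzan2024, Lemma 4 (p. 9), Question 7 (p. 36)] [cite: VandenbergHaggstromKahn2005, Thm. 1.5 (p. 7)]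
-/

namespace Summit.CriticalPhenomena.PercolationContinuityZ3.Cruxes.AdditiveGluing.TieLine

open MeasureTheory Set Literature.Probability.LatticeModels Literature.Probability.Percolation
open Summit.CriticalPhenomena.PercolationContinuityZ3.Theorems

noncomputable section

namespace K0OfCovTransfer

/-! ### Real algebra of the chain -/

/-- The chain (α) ≥ τ-order ≥ (β) with `S = a_o N − a_c NJ ≥ 0` (γ), divided by `d = μ(D)` (or trivial if `d = 0`, when
`P_c = Q_o = 0`): `NJ·(P_c − Q_c) ≤ N·(P_o − Q_o)`, written with `M − G_x = m_V − (m_V − P_x + Q_x)`. [folklore] -/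
theorem alg {d mV mU ao ac N NJ Po Pc Qo Qc : ℝ}
    (hα : mV * (ao * N - ac * NJ) ≤ d * (Po * N - Pc * NJ))
    (hβ : d * (Qo * N - Qc * NJ) ≤ mU * (ao * N - ac * NJ))
    (hγ : ac * NJ ≤ ao * N) (hτ : mU ≤ mV) (hd : 0 ≤ d) (hN : 0 ≤ N) (hNJ : 0 ≤ NJ)
    (hPo : 0 ≤ Po) (hQc : 0 ≤ Qc) (hPc : Pc ≤ d) (hQo : Qo ≤ d) :
    NJ * (mV - (mV - Pc + Qc)) ≤ N * (mV - (mV - Po + Qo)) := by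
  rcases hd.eq_or_lt with h0 | hpos
  · -- `μ(D) = 0`: then `P_c = Q_o = 0`
    have h1 : 0 ≤ NJ * (Qc - Pc) := mul_nonneg hNJ (by linarith)
    have h2 : 0 ≤ N * (Po - Qo) := mul_nonneg hN (by linarith)
    linarith
  · have h1 : mU * (ao * N - ac * NJ) ≤ mV * (ao * N - ac * NJ) :=
      mul_le_mul_of_nonneg_right hτ (sub_nonneg.2 hγ)
    have h2 : d * (NJ * (mV - (mV - Pc + Qc))) ≤ d * (N * (mV - (mV - Po + Qo))) := by linarith
    exact le_of_mul_le_mul_left h2 hpos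

variable {n : ℕ}

/-! ### Set identities and their measure versions -/

/-- `{u ↮ b} ∩ {v ↔ b} = {u ↮ v} ∩ {v ↔ b}` (given `v ↔ b`: `u ↮ b ⟺ u ↮ v`). [folklore] -/
theorem compl_inter_openConn_eq (b u v : Fin n) :
    ((openConn u b)ᶜ ∩ openConn v b : Set (BondConfig (Fin n))) = (openConn u v)ᶜ ∩ openConn v b := by
  ext ω
  simp only [mem_inter_iff, mem_compl_iff, openConn, mem_setOf_eq]
  constructor
  · rintro ⟨hub, hvb⟩
    exact ⟨fun huv => hub (huv.trans hvb), hvb⟩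
  · rintro ⟨huv, hvb⟩
    exact ⟨fun hub => huv (hub.trans hvb.symm), hvb⟩

/-- `M = μ(a₁↔b ∪ a₂↔b) − τ_{a₂} = μ({a₂ ↮ a₁} ∩ {a₁ ↔ b})` (`ML5Driver.real_Gu_eq` and `compl_inter_openConn_eq`).
[cite: KozmaNitzan2024, Lemma 4 (p. 9)] -/
theorem real_gainMax_eq (w : Sym2 (Fin n) → unitInterval) (b a₁ a₂ : Fin n) :
    (prodBernoulli w).real (openConn a₁ b ∪ openConn a₂ b : Set (BondConfig (Fin n))) -
        (prodBernoulli w).real (openConn a₂ b : Set (BondConfig (Fin n))) =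
      (prodBernoulli w).real ((openConn a₂ a₁)ᶜ ∩ openConn a₁ b : Set (BondConfig (Fin n))) := by
  rw [← compl_inter_openConn_eq b a₂ a₁, Set.union_comm]
  exact (ML5Driver.real_Gu_eq w b a₂ a₁).symm

/-- **τ-order on `D = {a₂ ↮ a₁}`**: if `τ_{a₂} ≤ τ_{a₁}` then `μ(D ∩ a₂↔b) ≤ μ(D ∩ a₁↔b)`, since
`μ(D ∩ a₁↔b) − μ(D ∩ a₂↔b) = τ_{a₁} − τ_{a₂}` (off `D` the two events agree). [cite: KozmaNitzan2024, Lemma 4 (p. 9)] -/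
theorem real_D_inter_le (w : Sym2 (Fin n) → unitInterval) (b a₁ a₂ : Fin n)
    (hτ : (prodBernoulli w).real (openConn a₂ b : Set (BondConfig (Fin n))) ≤
      (prodBernoulli w).real (openConn a₁ b : Set (BondConfig (Fin n)))) :
    (prodBernoulli w).real ((openConn a₂ a₁)ᶜ ∩ openConn a₂ b : Set (BondConfig (Fin n))) ≤
      (prodBernoulli w).real ((openConn a₂ a₁)ᶜ ∩ openConn a₁ b : Set (BondConfig (Fin n))) := by
  have h1 := real_gainMax_eq w b a₁ a₂
  have h2 := real_gainMax_eq w b a₂ a₁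
  rw [KNPreFKG.openConn_symm a₁ a₂, Set.union_comm] at h2
  linarith

/-- **The gain event splits along the relay `x` hangs on** (`D = {a₂ ↮ a₁}`):
`{x↮b} ∩ ({x↔a₁} ∪ {x↔a₂}) ∩ ({a₁↔b} ∪ {a₂↔b}) = (D ∩ {a₁↔b} ∩ {x↔a₂}) ∪ (D ∩ {a₂↔b} ∩ {a₁↔x})`:
if `x ↔ a₂` then `a₂ ↮ b` (else `x ↔ b`), so `a₁ ↔ b` and `a₂ ↮ a₁`; symmetrically if `x ↔ a₁`; conversely on either
piece `x ↮ b` because `x` and `b` hang on different, non-joined relays. [cite: KozmaNitzan2024, Lemma 4 (p. 9)] -/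
theorem gain_eq_union (x b a₁ a₂ : Fin n) :
    ((openConn x b)ᶜ ∩ (openConn x a₁ ∪ openConn x a₂) ∩ (openConn a₁ b ∪ openConn a₂ b) : Set (BondConfig (Fin n))) =
      ((openConn a₂ a₁)ᶜ ∩ openConn a₁ b ∩ openConn x a₂) ∪ ((openConn a₂ a₁)ᶜ ∩ openConn a₂ b ∩ openConn a₁ x) := by
  ext ω
  simp only [mem_inter_iff, mem_compl_iff, mem_union, openConn, mem_setOf_eq]
  constructor
  · rintro ⟨⟨hxb, hx1 | hx2⟩, hb⟩
    · have h1b : ¬ (openGraph ω).Reachable a₁ b := fun h => hxb (hx1.trans h)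
      have h2b : (openGraph ω).Reachable a₂ b := hb.resolve_left h1b
      exact Or.inr ⟨⟨fun h21 => h1b (h21.symm.trans h2b), h2b⟩, hx1.symm⟩
    · have h2b : ¬ (openGraph ω).Reachable a₂ b := fun h => hxb (hx2.trans h)
      have h1b : (openGraph ω).Reachable a₁ b := hb.resolve_right h2b
      exact Or.inl ⟨⟨fun h21 => h2b (h21.trans h1b), h1b⟩, hx2⟩
  · rintro (⟨⟨h21, h1b⟩, hx2⟩ | ⟨⟨h21, h2b⟩, h1x⟩)
    · exact ⟨⟨fun hxb => h21 ((hx2.symm.trans hxb).trans h1b.symm), Or.inr hx2⟩, Or.inl h1b⟩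
    · exact ⟨⟨fun hxb => h21 (h2b.trans (hxb.symm.trans h1x.symm)), Or.inl h1x.symm⟩, Or.inr h2b⟩

/-- The two pieces of the gain event are disjoint (`x ↔ a₂` and `a₁ ↔ x` would join `a₂` to `a₁`). [folklore] -/
theorem gain_pieces_disjoint (x b a₁ a₂ : Fin n) :
    Disjoint ((openConn a₂ a₁)ᶜ ∩ openConn a₁ b ∩ openConn x a₂ : Set (BondConfig (Fin n)))
      ((openConn a₂ a₁)ᶜ ∩ openConn a₂ b ∩ openConn a₁ x) := by
  rw [Set.disjoint_left]
  intro ω h1 h2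
  simp only [mem_inter_iff, mem_compl_iff, openConn, mem_setOf_eq] at h1 h2
  exact h1.1.1 (h1.2.symm.trans h2.2.symm)

/-- **`G_x = μ(D ∩ a₁↔b) − P_x + Q_x`**: the measure of the gain event of `x` is
`μ(D ∩ {a₁↔b} ∩ {x↔a₂}) + μ(D ∩ {a₂↔b} ∩ {a₁↔x})`, and `μ(D ∩ {a₁↔b} ∩ {x↔a₂}) = μ(D ∩ a₁↔b) − μ(D ∩ {a₁↔b} ∩ {x↮a₂})`.
[cite: KozmaNitzan2024, Lemma 4 (p. 9)] -/
theorem real_gain_eq (w : Sym2 (Fin n) → unitInterval) (x b a₁ a₂ : Fin n) :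
    (prodBernoulli w).real
        ((openConn x b)ᶜ ∩ (openConn x a₁ ∪ openConn x a₂) ∩ (openConn a₁ b ∪ openConn a₂ b) : Set (BondConfig (Fin n))) =
      (prodBernoulli w).real ((openConn a₂ a₁)ᶜ ∩ openConn a₁ b : Set (BondConfig (Fin n))) -
          (prodBernoulli w).real ((openConn a₂ a₁)ᶜ ∩ openConn a₁ b ∩ (openConn x a₂)ᶜ : Set (BondConfig (Fin n))) +
        (prodBernoulli w).real ((openConn a₂ a₁)ᶜ ∩ openConn a₂ b ∩ openConn a₁ x : Set (BondConfig (Fin n))) := by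
  rw [gain_eq_union x b a₁ a₂, measureReal_union (gain_pieces_disjoint x b a₁ a₂) MeasurableSet.of_discrete]
  have h := ML5EdgeIdentity.real_eq_inter_add_inter_compl w
    ((openConn a₂ a₁)ᶜ ∩ openConn a₁ b : Set (BondConfig (Fin n))) (openConn x a₂)
  linarith

end K0OfCovTransfer

open K0OfCovTransfer in
/-- **(K₀) ⟸ attachment transfer (γ) + covariance transfer (α) + (β)** [+ τ-order]: the landed attachment transfer
(registered stub `stub_k0AttachTransfer_c9`, hypothesis `hA`) and the two covariance-transfer statements (registered stubs
`stub_k0CovTransferP_c9`, `stub_k0CovTransferQ_c9`, hypotheses `hP`, `hQ`) imply the slack-inheritance kernel (K₀)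
(registered stub `stub_k0_dp`), so that
`stub_k0_dp := k0_of_covTransfer stub_k0AttachTransfer_c9 stub_k0CovTransferP_c9 stub_k0CovTransferQ_c9`.  With `u = a₂` (weaker), `v = a₁`:
chain `μ(D)(P_o N − P_c NJ) ≥ μ(D∩v↔b) S ≥ μ(D∩u↔b) S ≥ μ(D)(Q_o N − Q_c NJ)` (`S = a_o N − a_c NJ ≥ 0` by (γ)), then
`M − G_x = P_x − Q_x` (`real_gainMax_eq`, `real_gain_eq`).
[cite: KozmaNitzan2024, Lemma 4 (p. 9), Question 7 (p. 36)] [cite: VandenbergHaggstromKahn2005, Thm. 1.5 (p. 7)] -/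
theorem k0_of_covTransfer
    (hA : ∀ (n : ℕ) (w : Sym2 (Fin n) → unitInterval) (o u v c : Fin n), (Literature.Probability.LatticeModels.prodBernoulli w).real ((Literature.Probability.Percolation.openConn u v)ᶜ ∩ Literature.Probability.Percolation.openConn v c : Set (Literature.Probability.Percolation.BondConfig (Fin n))) * (Literature.Probability.LatticeModels.prodBernoulli w).real ((Literature.Probability.Percolation.openConn c u)ᶜ ∩ (Literature.Probability.Percolation.openConn c v)ᶜ ∩ Literature.Probability.Percolation.openConn o c : Set (Literature.Probability.Percolation.BondConfig (Fin n))) ≤ (Literature.Probability.LatticeModels.prodBernoulli w).real ((Literature.Probability.Percolation.openConn u v)ᶜ ∩ Literature.Probability.Percolation.openConn v o : Set (Literature.Probability.Percolation.BondConfig (Fin n))) * (Literature.Probability.LatticeModels.prodBernoulli w).real ((Literature.Probability.Percolation.openConn c u)ᶜ ∩ (Literature.Probability.Percolation.openConn c v)ᶜ : Set (Literature.Probability.Percolation.BondConfig (Fin n))))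
    (hP : ∀ (n : ℕ) (w : Sym2 (Fin n) → unitInterval) (o b u v c : Fin n), (Literature.Probability.LatticeModels.prodBernoulli w).real ((Literature.Probability.Percolation.openConn u v)ᶜ ∩ Literature.Probability.Percolation.openConn v b : Set (Literature.Probability.Percolation.BondConfig (Fin n))) * ((Literature.Probability.LatticeModels.prodBernoulli w).real ((Literature.Probability.Percolation.openConn u v)ᶜ ∩ Literature.Probability.Percolation.openConn v o : Set (Literature.Probability.Percolation.BondConfig (Fin n))) * (Literature.Probability.LatticeModels.prodBernoulli w).real ((Literature.Probability.Percolation.openConn c u)ᶜ ∩ (Literature.Probability.Percolation.openConn c v)ᶜ : Set (Literature.Probability.Percolation.BondConfig (Fin n))) - (Literature.Probability.LatticeModels.prodBernoulli w).real ((Literature.Probability.Percolation.openConn u v)ᶜ ∩ Literature.Probability.Percolation.openConn v c : Set (Literature.Probability.Percolation.BondConfig (Fin n))) * (Literature.Probability.LatticeModels.prodBernoulli w).real ((Literature.Probability.Percolation.openConn c u)ᶜ ∩ (Literature.Probability.Percolation.openConn c v)ᶜ ∩ Literature.Probability.Percolation.openConn o c : Set (Literature.Probability.Percolation.BondConfig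 (Fin n)))) ≤ (Literature.Probability.LatticeModels.prodBernoulli w).real ((Literature.Probability.Percolation.openConn u v)ᶜ : Set (Literature.Probability.Percolation.BondConfig (Fin n))) * ((Literature.Probability.LatticeModels.prodBernoulli w).real ((Literature.Probability.Percolation.openConn u v)ᶜ ∩ Literature.Probability.Percolation.openConn v b ∩ (Literature.Probability.Percolation.openConn o u)ᶜ : Set (Literature.Probability.Percolation.BondConfig (Fin n))) * (Literature.Probability.LatticeModels.prodBernoulli w).real ((Literature.Probability.Percolation.openConn c u)ᶜ ∩ (Literature.Probability.Percolation.openConn c v)ᶜ : Set (Literature.Probability.Percolation.BondConfig (Fin n))) - (Literature.Probability.LatticeModels.prodBernoulli w).real ((Literature.Probability.Percolation.openConn u v)ᶜ ∩ Literature.Probability.Percolation.openConn v b ∩ (Literature.Probability.Percolation.openConn c u)ᶜ : Set (Literature.Probability.Percolation.BondConfig (Fin n))) * (Literature.Probability.LatticeModels.prodBernoulli w).real ((Literature.Probability.Percolation.openConn c u)ᶜ ∩ (Literature.Probability.Percolation.openConn c v)ᶜ ∩ Literature.Probability.Percolation.openConn o c : Set (Literature.Probability.Percolation.BondConfig (Fin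 n)))))
    (hQ : ∀ (n : ℕ) (w : Sym2 (Fin n) → unitInterval) (o b u v c : Fin n), (Literature.Probability.LatticeModels.prodBernoulli w).real ((Literature.Probability.Percolation.openConn u v)ᶜ : Set (Literature.Probability.Percolation.BondConfig (Fin n))) * ((Literature.Probability.LatticeModels.prodBernoulli w).real ((Literature.Probability.Percolation.openConn u v)ᶜ ∩ Literature.Probability.Percolation.openConn u b ∩ Literature.Probability.Percolation.openConn v o : Set (Literature.Probability.Percolation.BondConfig (Fin n))) * (Literature.Probability.LatticeModels.prodBernoulli w).real ((Literature.Probability.Percolation.openConn c u)ᶜ ∩ (Literature.Probability.Percolation.openConn c v)ᶜ : Set (Literature.Probability.Percolation.BondConfig (Fin n))) - (Literature.Probability.LatticeModels.prodBernoulli w).real ((Literature.Probability.Percolation.openConn u v)ᶜ ∩ Literature.Probability.Percolation.openConn u b ∩ Literature.Probability.Percolation.openConn v c : Set (Literature.Probability.Percolation.BondConfig (Fin n))) * (Literature.Probability.LatticeModels.prodBernoulli w).real ((Literature.Probability.Percolation.openConn c u)ᶜ ∩ (Literature.Probability.Percolation.openConn c v)ᶜ ∩ Literature.Probability.Percolation.openConn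 o c : Set (Literature.Probability.Percolation.BondConfig (Fin n)))) ≤ (Literature.Probability.LatticeModels.prodBernoulli w).real ((Literature.Probability.Percolation.openConn u v)ᶜ ∩ Literature.Probability.Percolation.openConn u b : Set (Literature.Probability.Percolation.BondConfig (Fin n))) * ((Literature.Probability.LatticeModels.prodBernoulli w).real ((Literature.Probability.Percolation.openConn u v)ᶜ ∩ Literature.Probability.Percolation.openConn v o : Set (Literature.Probability.Percolation.BondConfig (Fin n))) * (Literature.Probability.LatticeModels.prodBernoulli w).real ((Literature.Probability.Percolation.openConn c u)ᶜ ∩ (Literature.Probability.Percolation.openConn c v)ᶜ : Set (Literature.Probability.Percolation.BondConfig (Fin n))) - (Literature.Probability.LatticeModels.prodBernoulli w).real ((Literature.Probability.Percolation.openConn u v)ᶜ ∩ Literature.Probability.Percolation.openConn v c : Set (Literature.Probability.Percolation.BondConfig (Fin n))) * (Literature.Probability.LatticeModels.prodBernoulli w).real ((Literature.Probability.Percolation.openConn c u)ᶜ ∩ (Literature.Probability.Percolation.openConn c v)ᶜ ∩ Literature.Probability.Percolation.openConn o c : Set (Literature.Probability.Percolation.BondConfig (Fin n))))) :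
    ∀ (n : ℕ) (w : Sym2 (Fin n) → unitInterval) (o b a₁ a₂ c : Fin n), (Literature.Probability.LatticeModels.prodBernoulli w).real (Literature.Probability.Percolation.openConn a₂ b) ≤ (Literature.Probability.LatticeModels.prodBernoulli w).real (Literature.Probability.Percolation.openConn a₁ b) → (Literature.Probability.LatticeModels.prodBernoulli w).real ((Literature.Probability.Percolation.openConn c a₁)ᶜ ∩ (Literature.Probability.Percolation.openConn c a₂)ᶜ ∩ Literature.Probability.Percolation.openConn o c) * ((Literature.Probability.LatticeModels.prodBernoulli w).real (Literature.Probability.Percolation.openConn a₁ b ∪ Literature.Probability.Percolation.openConn a₂ b) - (Literature.Probability.LatticeModels.prodBernoulli w).real (Literature.Probability.Percolation.openConn a₂ b) - (Literature.Probability.LatticeModels.prodBernoulli w).real ((Literature.Probability.Percolation.openConn c b)ᶜ ∩ (Literature.Probability.Percolation.openConn c a₁ ∪ Literature.Probability.Percolation.openConn c a₂) ∩ (Literature.Probability.Percolation.openConn a₁ b ∪ Literature.Probability.Percolation.openConn a₂ b))) ≤ (Literature.Probability.LatticeModels.prodBernoulli w).real ((Literature.Probability.Percolation.openConn c a₁)ᶜ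 ∩ (Literature.Probability.Percolation.openConn c a₂)ᶜ : Set (Literature.Probability.Percolation.BondConfig (Fin n))) * ((Literature.Probability.LatticeModels.prodBernoulli w).real (Literature.Probability.Percolation.openConn a₁ b ∪ Literature.Probability.Percolation.openConn a₂ b) - (Literature.Probability.LatticeModels.prodBernoulli w).real (Literature.Probability.Percolation.openConn a₂ b) - (Literature.Probability.LatticeModels.prodBernoulli w).real ((Literature.Probability.Percolation.openConn o b)ᶜ ∩ (Literature.Probability.Percolation.openConn o a₁ ∪ Literature.Probability.Percolation.openConn o a₂) ∩ (Literature.Probability.Percolation.openConn a₁ b ∪ Literature.Probability.Percolation.openConn a₂ b))) := by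
  intro n w o b a₁ a₂ c hτ
  have hα := hP n w o b a₂ a₁ c
  have hβ := hQ n w o b a₂ a₁ c
  have hγ := hA n w o a₂ a₁ c
  have hNs : ((openConn c a₂)ᶜ ∩ (openConn c a₁)ᶜ : Set (BondConfig (Fin n))) = (openConn c a₁)ᶜ ∩ (openConn c a₂)ᶜ :=
    Set.inter_comm _ _
  rw [hNs] at hα hβ hγ
  rw [real_gainMax_eq w b a₁ a₂, real_gain_eq w o b a₁ a₂, real_gain_eq w c b a₁ a₂]
  exact alg hα hβ hγ (real_D_inter_le w b a₁ a₂ hτ) measureReal_nonneg measureReal_nonneg measureReal_nonneg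
    measureReal_nonneg measureReal_nonneg (measureReal_mono (inter_subset_left.trans inter_subset_left))
    (measureReal_mono (inter_subset_left.trans inter_subset_left))

end

end Summit.CriticalPhenomena.PercolationContinuityZ3.Cruxes.AdditiveGluing.TieLine
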